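import Summits.CriticalPhenomena.CardyFormulaZ2.Theorems.CardySusyWardParafermionFamiliesToSLESixCornerFormStructureB
import Literature.Probability.LatticeModels.CornerPermutation

/-!
# The boundary trace of the corner flow along a flat diagonal free side (helper `freeTrace_direction_diag` of
# `stub_traceIdentification`, line `exact-potential-schwarz-christoffel`, crux stmt-CriticalPhenomena-10814), A:
# the darts of the exploration around a touch of general index

Helper file (generic lattice/orbit lemmas; part B applies them in the wall package of a flat diagonal free
piece). Admissible Dobrushin data `E`, completed configurations `β = E.bcBondConfig ω`, cut orbit `orb` of the
start corner, exit time `T`, turn count `tc`.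

A TOUCH OF INDEX `j : Fin 4` is a dart `(x, j)` (vertex `x`, face `faceAt x j`) whose two edges
`s(x, x + u_j)`, `s(x, x + u_{j+1})` (`u = cornerUnit`) end on the dual-wired arc `B` — on a flat diagonal free side
of orientation `(a, b) = u_j + u_{j+1}` every site of the last level but two is touched this way, always with
the same `j`.

* `touch_step`: after a touch `orb n = (x, j)` the next four darts are forced as soon as the two edges
  `s(x, x + u_{j+2})`, `s(x + u_{j+2}, x')` (`x' = x + u_{j+2} + u_{j+1}`, the next site of the side) are open:
  `(x, j+1)`, `(x + u_{j+2}, j)`, `(x', j+3)` — all three in the VALLEY FACE `faceAt x (j+1) = faceAt x' (j+3)`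
  (`faceAt_valley`, `faceAt_next_in`) — and the next touch `(x', j)`; turn counts `tc n + 1, tc n, tc n - 1, tc n`.
* `turnCount_out`, `turnCount_in`: if every visit of the touch dart `(x, j)` has turn count `τ`, every visit of
  the outgoing dart `(x, j+1)` has `τ + 1` and every visit of the ingoing dart `(x, j+3)` has `τ - 1`.
* `cornerObs_dart_of_turnCount`: a dart of an inner face with a `B`-corner visited with constant turn count `τ`
  has `cornerObs E δ x f = sixthPhase τ · P[x ↔ A]` at every reading mesh `δ ≠ 0`, and its ALL-OPEN phase
  `cornerPhase δ E x f univ` is `sixthPhase τ` as soon as `P[x ↔ A] > 0` (tree: `CornerForm.cornerObs_eq_of_turnCount`,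
  `visit_iff_reachable`, `touch_mono`, `cornerPhase_eq_dartW`).
* `sixthPhase_sub_one_add`: `sixthPhase (τ-1) + sixthPhase (τ+1) = √3 · sixthPhase τ`; `norm_tracePhase`:
  `‖sixthPhase τ · (√2 (-1+i)/2 · iᵏ)‖ = 1` (the dart `(v, faceAt v k)` points along `√2 (-1+i)/2 · iᵏ`,
  `FacePotential.dart_dir_faceAt`).
* Diagonal bookkeeping: every orientation `a, b = ±1` has a touch index (`exists_touchIndex`:
  `(a, b) = u_j + u_{j+1}`), the levels `a v₀ + b v₁` / columns `a v₀ - b v₁` of the units at a touch index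
  (`coords_of_touchIndex`), sites from level and column (`eq_of_level_column`), and two interval lemmas
  (`abs_step_le`, `col_of_near`).
Registered one-line ticket `freeTrace_direction_diagA` (= the core of `touch_step`).
(buildfix 2026-08-20: comment-only re-land to re-enqueue the module build after its blocking imports were repaired; no declaration changed.)
(buildfix 2026-08-20, 09:4xZ: re-enqueue — the 05:1x/05:2x lake attempt ran while the imports were mid-repair (rc 76 / false-green, never re-queued); the closure is rebuilt and green now; no declaration changed.)
-/

noncomputable section

namespace Summit.CriticalPhenomena.CardyFormulaZ2.Theorems.ParafermionFamiliesToSLESix.FreeTrace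

open MeasureTheory Complex
open Literature.Probability.Percolation (bondPercolation half BondConfig openGraph)
open Literature.Probability.LatticeModels
open Literature.Probability.LatticeModels.DiscreteDobrushin (startCorner exitTime isStartCorner_startCorner
  isInnerFace_of_lt_exitTime not_isInnerFace_exitTime)
open Summit.CriticalPhenomena.CardyFormulaZ2.Cruxes.EdgePrecompact.QkzStripBoundaryArm (cornerObs)
open Summit.CriticalPhenomena.CardyFormulaZ2.Cruxes.CoherentMorera.FinitaryGreenPairing (cornerPhase)
open Summit.CriticalPhenomena.CardyFormulaZ2.Theorems.ParafermionFamiliesToSLESix.StripAnchored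
open S2 (sixthPhase sixthPhase_add sixthPhase_eq)

variable {E : DiscreteDobrushin}

/-! ## Faces around a touch of index `j` -/

/-- **The valley face**: the face `j` at the lower neighbour `x + u_{j+2}` is the face `j + 1` at `x`. [folklore] -/
theorem faceAt_valley (x : Site 2) (j : Fin 4) : faceAt (x + cornerUnit (j + 2)) j = faceAt x (j + 1) := by
  have h := faceAt_add_unit_add_two x (j + 2)
  rwa [fin4_add_two_add_two', fin4_add_two_add_three] at h

/-- **The ingoing face of the next site is the outgoing face of the previous one**: with
`x' = x + u_{j+2} + u_{j+1}`, `faceAt x' (j + 3) = faceAt x (j + 1)`. [folklore] -/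
theorem faceAt_next_in (x : Site 2) (j : Fin 4) :
    faceAt (x + cornerUnit (j + 2) + cornerUnit (j + 1)) (j + 3) = faceAt x (j + 1) := by
  have h := faceAt_add_unit_add_two (x + cornerUnit (j + 2)) (j + 1)
  rw [fin4_add_one_add_two, fin4_add_one_add_three] at h
  rw [h, faceAt_valley]

/-- The next site's `j`-th neighbour is the previous site's `(j+1)`-st: `x' + u_j = x + u_{j+1}`. [folklore] -/
theorem next_add_unit (x : Site 2) (j : Fin 4) :
    x + cornerUnit (j + 2) + cornerUnit (j + 1) + cornerUnit j = x + cornerUnit (j + 1) := by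
  rw [cornerUnit_add_two]; abel

/-! ## Four forced steps after a touch -/

/-- **Four steps after a touch of index `j`.** If `orb n = (x, j)` (`n < T`) with `x + u_{j+1} ∈ B`, inner
valley face `faceAt x (j+1)` and inner next touch face `faceAt x' j` (`x' = x + u_{j+2} + u_{j+1}`), and the edges
`s(x, x + u_{j+2})`, `s(x + u_{j+2}, x')` are open, then the next four darts are `(x, j+1)`, `(x + u_{j+2}, j)`,
`(x', j+3)`, `(x', j)`, all before the exit, with turn counts `tc n + 1, tc n, tc n - 1, tc n` (cross the closed
`s(x, x + u_{j+1})`, follow the two open edges, cross the closed `s(x', x' + u_j) = s(x', x + u_{j+1})`).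
[cite: Smirnov2001, §2] -/
theorem touch_step (hE : E.IsZdAdmissible) {x : Site 2} {j : Fin 4} (hB1 : x + cornerUnit (j + 1) ∈ E.zdArcB)
    (hf1 : E.IsInnerFace (faceAt x (j + 1)))
    (hf2 : E.IsInnerFace (faceAt (x + cornerUnit (j + 2) + cornerUnit (j + 1)) j))
    {ω : BondConfig (Site 2)} {n : ℕ} (hn : n < exitTime hE ω)
    (h : cornerOrbit (E.bcBondConfig ω) (startCorner hE) n = (x, j))
    (ho1 : s(x, x + cornerUnit (j + 2)) ∈ E.bcBondConfig ω)
    (ho2 : s(x + cornerUnit (j + 2), x + cornerUnit (j + 2) + cornerUnit (j + 1)) ∈ E.bcBondConfig ω) :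
    n + 4 < exitTime hE ω ∧
      cornerOrbit (E.bcBondConfig ω) (startCorner hE) (n + 1) = (x, j + 1) ∧
      cornerOrbit (E.bcBondConfig ω) (startCorner hE) (n + 2) = (x + cornerUnit (j + 2), j) ∧
      cornerOrbit (E.bcBondConfig ω) (startCorner hE) (n + 3) = (x + cornerUnit (j + 2) + cornerUnit (j + 1), j + 3) ∧
      cornerOrbit (E.bcBondConfig ω) (startCorner hE) (n + 4) = (x + cornerUnit (j + 2) + cornerUnit (j + 1), j) ∧
      turnCount (E.bcBondConfig ω) (startCorner hE) (n + 1) = turnCount (E.bcBondConfig ω) (startCorner hE) n + 1 ∧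
      turnCount (E.bcBondConfig ω) (startCorner hE) (n + 2) = turnCount (E.bcBondConfig ω) (startCorner hE) n ∧
      turnCount (E.bcBondConfig ω) (startCorner hE) (n + 3) = turnCount (E.bcBondConfig ω) (startCorner hE) n - 1 ∧
      turnCount (E.bcBondConfig ω) (startCorner hE) (n + 4) = turnCount (E.bcBondConfig ω) (startCorner hE) n := by
  -- adapted from `S5.touch_shift` (`…AnchoredWallFluxDarts.lean`, the case `j = 0`)
  set x' := x + cornerUnit (j + 2) + cornerUnit (j + 1) with hx'
  -- step 1: cross the closed edge `s(x, x + u_{j+1})`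
  have hc0 : cTgt (x, j) ∉ E.bcBondConfig ω :=
    DiscreteDobrushin.not_mem_bcBondConfig_of_mem_zdArcB hE (Sym2.mem_mk_right _ _) hB1
  have h1 : cornerOrbit (E.bcBondConfig ω) (startCorner hE) (n + 1) = (x, j + 1) := by
    rw [cornerOrbit_succ, h, nextCorner_of_not_mem hc0]
  have hn1 : n + 1 < exitTime hE ω := S5.succ_lt_exitTime hE hn (by rw [h1]; exact hf1)
  -- step 2: follow the open edge `s(x, x + u_{j+2})`
  have hc1 : cTgt (x, j + 1) ∈ E.bcBondConfig ω := by
    show s(x, x + cornerUnit (j + 1 + 1)) ∈ E.bcBondConfig ω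
    rw [fin4_add_one_add_one]; exact ho1
  have h2 : cornerOrbit (E.bcBondConfig ω) (startCorner hE) (n + 2) = (x + cornerUnit (j + 2), j) := by
    rw [cornerOrbit_succ, h1, nextCorner_of_mem hc1]
    exact Prod.ext (by simp only; rw [fin4_add_one_add_one]) (fin4_add_one_add_three j)
  have hn2 : n + 2 < exitTime hE ω :=
    S5.succ_lt_exitTime hE hn1 (by rw [h2]; show E.IsInnerFace (faceAt _ _); rw [faceAt_valley]; exact hf1)
  -- step 3: follow the open edge `s(x + u_{j+2}, x')`
  have hc2 : cTgt (x + cornerUnit (j + 2), j) ∈ E.bcBondConfig ω := ho2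
  have h3 : cornerOrbit (E.bcBondConfig ω) (startCorner hE) (n + 3) = (x', j + 3) := by
    rw [cornerOrbit_succ, h2, nextCorner_of_mem hc2]
  have hn3 : n + 3 < exitTime hE ω :=
    S5.succ_lt_exitTime hE hn2 (by rw [h3]; show E.IsInnerFace (faceAt _ _); rw [faceAt_next_in]; exact hf1)
  -- step 4: cross the closed edge `s(x', x' + u_j) = s(x', x + u_{j+1})`
  have hc3 : cTgt (x', j + 3) ∉ E.bcBondConfig ω := by
    refine DiscreteDobrushin.not_mem_bcBondConfig_of_mem_zdArcB hE (Sym2.mem_mk_right _ _) ?_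
    show x' + cornerUnit (j + 3 + 1) ∈ E.zdArcB
    rw [fin4_add_three_add_one, hx', next_add_unit]; exact hB1
  have h4 : cornerOrbit (E.bcBondConfig ω) (startCorner hE) (n + 4) = (x', j) := by
    rw [cornerOrbit_succ, h3, nextCorner_of_not_mem hc3]
    exact Prod.ext rfl (fin4_add_three_add_one j)
  have hn4 : n + 4 < exitTime hE ω := S5.succ_lt_exitTime hE hn3 (by rw [h4]; exact hf2)
  refine ⟨hn4, h1, h2, h3, h4, ?_, ?_, ?_, ?_⟩
  · rw [turnCount_succ, h, turnSign_of_not_mem hc0]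
  · rw [turnCount_succ, h1, turnSign_of_mem hc1, turnCount_succ, h, turnSign_of_not_mem hc0]; ring
  · rw [turnCount_succ, h2, turnSign_of_mem hc2, turnCount_succ, h1, turnSign_of_mem hc1, turnCount_succ, h,
      turnSign_of_not_mem hc0]; ring
  · rw [turnCount_succ, h3, turnSign_of_not_mem hc3, turnCount_succ, h2, turnSign_of_mem hc2, turnCount_succ, h1,
      turnSign_of_mem hc1, turnCount_succ, h, turnSign_of_not_mem hc0]; ring

/-! ## The two flux darts of a touch -/

/-- **The outgoing dart.** For `x ∉ A` with `x + u_{j+1} ∈ B`: if every visit of the touch dart `(x, j)` has turn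
count `τ`, every visit of `(x, j + 1)` has turn count `τ + 1` (its predecessor is the touch, across the closed
edge `s(x, x + u_{j+1})`: `S5.orbit_pred`). [cite: DuminilCopin2012Parafermion, Proposition 5] -/
theorem turnCount_out (hE : E.IsZdAdmissible) {x : Site 2} {j : Fin 4} (hxA : x ∉ E.zdArcA)
    (hB1 : x + cornerUnit (j + 1) ∈ E.zdArcB) (τ : ℤ)
    (hτ : ∀ (ω : BondConfig (Site 2)) (n : ℕ), n < exitTime hE ω →
      cornerOrbit (E.bcBondConfig ω) (startCorner hE) n = (x, j) → turnCount (E.bcBondConfig ω) (startCorner hE) n = τ)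
    (ω : BondConfig (Site 2)) (n : ℕ) (hn : n < exitTime hE ω)
    (h : cornerOrbit (E.bcBondConfig ω) (startCorner hE) n = (x, j + 1)) :
    turnCount (E.bcBondConfig ω) (startCorner hE) n = τ + 1 := by
  obtain ⟨n', rfl, hn', hc⟩ := S5.orbit_pred hE hxA hB1 h
  rw [fin4_add_one_add_three] at hn' hc
  rw [turnCount_succ, hn', turnSign_of_not_mem hc, hτ ω n' (by omega) hn']

/-- **The ingoing dart.** For `x + u_j ∈ B` and inner touch face `faceAt x j`: if every visit of the touch dart
`(x, j)` has turn count `τ`, every visit of `(x, j + 3)` has turn count `τ - 1` (its successor is the touch, across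
the closed edge `s(x, x + u_j)`, still before the exit). [cite: DuminilCopin2012Parafermion, Proposition 5] -/
theorem turnCount_in (hE : E.IsZdAdmissible) {x : Site 2} {j : Fin 4} (hB0 : x + cornerUnit j ∈ E.zdArcB)
    (hf0 : E.IsInnerFace (faceAt x j)) (τ : ℤ)
    (hτ : ∀ (ω : BondConfig (Site 2)) (n : ℕ), n < exitTime hE ω →
      cornerOrbit (E.bcBondConfig ω) (startCorner hE) n = (x, j) → turnCount (E.bcBondConfig ω) (startCorner hE) n = τ)
    (ω : BondConfig (Site 2)) (n : ℕ) (hn : n < exitTime hE ω)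
    (h : cornerOrbit (E.bcBondConfig ω) (startCorner hE) n = (x, j + 3)) :
    turnCount (E.bcBondConfig ω) (startCorner hE) n = τ - 1 := by
  have hc : cTgt (x, j + 3) ∉ E.bcBondConfig ω := by
    refine DiscreteDobrushin.not_mem_bcBondConfig_of_mem_zdArcB hE (Sym2.mem_mk_right _ _) ?_
    show x + cornerUnit (j + 3 + 1) ∈ E.zdArcB
    rw [fin4_add_three_add_one]; exact hB0
  have h1 : cornerOrbit (E.bcBondConfig ω) (startCorner hE) (n + 1) = (x, j) := by
    rw [cornerOrbit_succ, h, nextCorner_of_not_mem hc]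
    exact Prod.ext rfl (fin4_add_three_add_one j)
  have hn1 : n + 1 < exitTime hE ω := S5.succ_lt_exitTime hE hn (by rw [h1]; exact hf0)
  have := hτ ω (n + 1) hn1 h1
  rw [turnCount_succ, h, turnSign_of_not_mem hc] at this
  omega

/-! ## Evaluation of a boundary dart with constant turn count -/

/-- **Evaluation of a free-arc dart with constant turn count.** For admissible data with hole-free inner faces,
a dart `(x, faceAt x i)` of an inner face with a corner `y` on the arc `B`, all of whose visits have turn count
`τ`: at every reading mesh `δ ≠ 0`, `cornerObs E δ x (faceAt x i) = sixthPhase τ · P[x ↔ A]`, and if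
`P[x ↔ A] > 0` the all-open phase `cornerPhase δ E x (faceAt x i) univ` equals `sixthPhase τ`.
[cite: DuminilCopin2012Parafermion, Proposition 5] -/
theorem cornerObs_dart_of_turnCount (hE : E.IsZdAdmissible) (hH : HoleFree {f : Site 2 | E.IsInnerFace f})
    {δ : ℝ} (hδ : δ ≠ 0) {x y : Site 2} {i : Fin 4} (hf : E.IsInnerFace (faceAt x i))
    (hy : IsCorner y (faceAt x i)) (hyB : y ∈ E.zdArcB) (τ : ℤ)
    (hτ : ∀ (ω : BondConfig (Site 2)) (n : ℕ), n < exitTime hE ω →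
      cornerOrbit (E.bcBondConfig ω) (startCorner hE) n = (x, i) → turnCount (E.bcBondConfig ω) (startCorner hE) n = τ) :
    cornerObs E δ x (faceAt x i) = sixthPhase τ *
        ((bondPercolation (zdGraph 2) half).real
          {ω | ∃ a ∈ E.zdArcA, (openGraph (E.bcBondConfig ω)).Reachable x a} : ℂ) ∧
      (0 < (bondPercolation (zdGraph 2) half).real
          {ω | ∃ a ∈ E.zdArcA, (openGraph (E.bcBondConfig ω)).Reachable x a} →
        cornerPhase δ E x (faceAt x i) (Set.univ : BondConfig (Site 2)) = sixthPhase τ) := by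
  have h1 : ((x, i) : Site 2 × Fin 4).1 = x := rfl
  have h2 : cFace (x, i) = faceAt x i := rfl
  have hf' : E.IsInnerFace (cFace (x, i)) := hf
  have hy' : IsCorner y (cFace (x, i)) := hy
  have hconn : {ω : BondConfig (Site 2) | ∃ a ∈ E.zdArcA, (openGraph (E.bcBondConfig ω)).Reachable x a} =
      {ω | ∃ n < exitTime hE ω, cornerOrbit (E.bcBondConfig ω) (startCorner hE) n = (x, i)} :=
    Set.ext fun ω => (CornerForm.visit_iff_reachable (ω := ω) hE hH hf' hy' hyB).symm
  rw [hconn]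
  refine ⟨CornerForm.cornerObs_eq_of_turnCount hE hδ h1 h2 τ hτ, fun hpos => ?_⟩
  have hne : {ω : BondConfig (Site 2) | ∃ n < exitTime hE ω,
      cornerOrbit (E.bcBondConfig ω) (startCorner hE) n = (x, i)}.Nonempty := by
    rw [Set.nonempty_iff_ne_empty]
    intro h0
    rw [h0, measureReal_empty] at hpos
    exact lt_irrefl _ hpos
  obtain ⟨ω, n, -, hωn⟩ := hne
  obtain ⟨m, hm, hmr⟩ := CornerForm.touch_mono hE hH hf' hy' hyB (Set.subset_univ ω) hωn
  rw [CornerForm.cornerPhase_eq_dartW hE hδ h1 h2, CornerForm.dartW_eq_of_visit hE hm hmr, hτ _ m hm hmr]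

/-! ## The touch index of a diagonal orientation -/

section Index

variable {δ t₀ : ℝ} {a b : ℤ} {j : Fin 4}

/-- **Every diagonal orientation has a touch index**: `(a, b) = u_j + u_{j+1}` for `j = 0, 3, 1, 2` when
`(a, b) = (1, 1), (1, -1), (-1, 1), (-1, -1)`. [folklore] -/
theorem exists_touchIndex (ha : a = 1 ∨ a = -1) (hb : b = 1 ∨ b = -1) :
    ∃ j : Fin 4, (Pi.single 0 a + Pi.single 1 b : Site 2) = cornerUnit j + cornerUnit (j + 1) := by
  rcases ha with rfl | rfl <;> rcases hb with rfl | rfl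
  · exact ⟨0, by decide⟩
  · exact ⟨3, by decide⟩
  · exact ⟨1, by decide⟩
  · exact ⟨2, by decide⟩

/-- **Coordinates of the units at a touch index.** If `(a, b) = u_j + u_{j+1}` then `a, b = ±1`, the units
`u_j`, `u_{j+1}` raise the level `a v₀ + b v₁` by one, `u_{j+2}` lowers it by one, and `u_{j+1}`, `u_{j+2}` shift
the column `a v₀ - b v₁` by the same sign `σ = ±1`. [folklore] -/
theorem coords_of_touchIndex (hj : (Pi.single 0 a + Pi.single 1 b : Site 2) = cornerUnit j + cornerUnit (j + 1)) :
    (a = 1 ∨ a = -1) ∧ (b = 1 ∨ b = -1) ∧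
      a * (cornerUnit j) 0 + b * (cornerUnit j) 1 = 1 ∧ a * (cornerUnit (j + 1)) 0 + b * (cornerUnit (j + 1)) 1 = 1 ∧
      a * (cornerUnit (j + 2)) 0 + b * (cornerUnit (j + 2)) 1 = -1 ∧
      a * (cornerUnit (j + 2)) 0 - b * (cornerUnit (j + 2)) 1 = a * (cornerUnit (j + 1)) 0 - b * (cornerUnit (j + 1)) 1 ∧
      (a * (cornerUnit (j + 1)) 0 - b * (cornerUnit (j + 1)) 1 = 1 ∨
        a * (cornerUnit (j + 1)) 0 - b * (cornerUnit (j + 1)) 1 = -1) := by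
  have h0 := congrFun hj 0
  have h1 := congrFun hj 1
  fin_cases j <;> simp [cornerUnit] at h0 h1 ⊢ <;> subst h0 <;> subst h1 <;> simp

/-- Sites are determined by level and column. [folklore] -/
theorem eq_of_level_column (ha : a = 1 ∨ a = -1) (hb : b = 1 ∨ b = -1) {x y : Site 2}
    (hl : a * x 0 + b * x 1 = a * y 0 + b * y 1) (hc : a * x 0 - b * x 1 = a * y 0 - b * y 1) : x = y := by
  have h0 : a * x 0 = a * y 0 := by omega
  have h1 : b * x 1 = b * y 1 := by omega
  ext i
  fin_cases i
  · show x 0 = y 0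
    rcases ha with rfl | rfl <;> omega
  · show x 1 = y 1
    rcases hb with rfl | rfl <;> omega

/-- A bound between two bounds: `|A| ≤ R` and `|A + (m + 1) s| ≤ R` give `|A + s| ≤ R`. [folklore] -/
theorem abs_step_le {A s R : ℝ} (m : ℕ) (h1 : |A| ≤ R) (h2 : |A + (m + 1) * s| ≤ R) : |A + s| ≤ R := by
  have key : ((m : ℝ) + 1) * (A + s) = m * A + (A + (m + 1) * s) := by ring
  have hm : (0 : ℝ) ≤ m := Nat.cast_nonneg m
  rw [abs_le] at h1 h2 ⊢
  obtain ⟨h1l, h1r⟩ := h1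
  obtain ⟨h2l, h2r⟩ := h2
  constructor <;> nlinarith

/-- **From integer column proximity to the real column box.** [folklore] -/
theorem col_of_near (hδ : 0 ≤ δ) {v y : Site 2} {m : ℕ} {T : ℝ}
    (h : |(a * y 0 - b * y 1) - (a * v 0 - b * v 1)| ≤ m) (hτ : |δ * ((a * v 0 - b * v 1 : ℤ) : ℝ) - t₀| ≤ T - m * δ) :
    |δ * ((a * y 0 - b * y 1 : ℤ) : ℝ) - t₀| ≤ T := by
  rw [abs_le] at h hτ ⊢
  obtain ⟨hl, hr⟩ := h
  have e1 : ((a * y 0 - b * y 1 : ℤ) : ℝ) ≤ ((a * v 0 - b * v 1 : ℤ) : ℝ) + m := by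
    exact_mod_cast (by omega : a * y 0 - b * y 1 ≤ (a * v 0 - b * v 1) + (m : ℤ))
  have e2 : ((a * v 0 - b * v 1 : ℤ) : ℝ) - m ≤ ((a * y 0 - b * y 1 : ℤ) : ℝ) := by
    exact_mod_cast (by omega : (a * v 0 - b * v 1) - (m : ℤ) ≤ a * y 0 - b * y 1)
  constructor <;> nlinarith

end Index

/-! ## Phases -/

/-- `sixthPhase (τ - 1) + sixthPhase (τ + 1) = √3 · sixthPhase τ` (`2 cos (π/6) = √3`). [folklore] -/
theorem sixthPhase_sub_one_add (τ : ℤ) :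
    sixthPhase (τ - 1) + sixthPhase (τ + 1) = (Real.sqrt 3 : ℂ) * sixthPhase τ := by
  have e : sixthPhase (-1) + sixthPhase 1 = (Real.sqrt 3 : ℂ) := by
    have e1 : Real.pi / 6 * ((1 : ℤ) : ℝ) = Real.pi / 6 := by push_cast; ring
    have e2 : Real.pi / 6 * ((-1 : ℤ) : ℝ) = -(Real.pi / 6) := by push_cast; ring
    rw [sixthPhase_eq, sixthPhase_eq, e1, e2, Real.cos_neg, Real.sin_neg, Real.cos_pi_div_six]
    push_cast
    ring
  rw [sub_eq_add_neg, sixthPhase_add, sixthPhase_add, ← mul_add, e, mul_comm]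

/-- The trace phases are unit vectors: `‖sixthPhase τ · (√2 · (-1 + i)/2 · iᵏ)‖ = 1`. [folklore] -/
theorem norm_tracePhase (τ : ℤ) (k : ℕ) :
    ‖sixthPhase τ * ((Real.sqrt 2 : ℂ) * ((-1 + I) / 2) * I ^ k)‖ = 1 := by
  have h2 : ‖((-1 : ℂ) + I)‖ = Real.sqrt 2 := by
    rw [Complex.norm_eq_sqrt_sq_add_sq]; norm_num
  rw [norm_mul, CornerForm.norm_sixthPhase, one_mul, norm_mul, norm_mul, norm_pow, Complex.norm_I, one_pow, mul_one,
    norm_div, h2, Complex.norm_real, Real.norm_of_nonneg (Real.sqrt_nonneg _)]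
  rw [show ‖(2 : ℂ)‖ = 2 by simp]
  rw [← mul_div_assoc, Real.mul_self_sqrt (by norm_num : (0:ℝ) ≤ 2)]
  norm_num

/-- **Registered one-line ticket `freeTrace_direction_diagA`** (helper A of `freeTrace_direction_diag`): four
darts after a touch of index `j` along two open edges comes the next touch, with the same turn count (`touch_step`).
[cite: Smirnov2001, §2] -/
theorem freeTrace_direction_diagA : ∀ (E : DiscreteDobrushin) (hE : E.IsZdAdmissible) (x : Site 2) (j : Fin 4) (ω : BondConfig (Site 2)) (n : ℕ), x + cornerUnit (j + 1) ∈ E.zdArcB → E.IsInnerFace (faceAt x (j + 1)) → E.IsInnerFace (faceAt (x + cornerUnit (j + 2) + cornerUnit (j + 1)) j) → n < exitTime hE ω → cornerOrbit (E.bcBondConfig ω) (startCorner hE) n = (x, j) → s(x, x + cornerUnit (j + 2)) ∈ E.bcBondConfig ω → s(x + cornerUnit (j + 2), x + cornerUnit (j + 2) + cornerUnit (j + 1)) ∈ E.bcBondConfig ω → n + 4 < exitTime hE ω ∧ cornerOrbit (E.bcBondConfig ω) (startCorner hE) (n + 4) = (x + cornerUnit (j + 2) + cornerUnit (j + 1),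 j) ∧ turnCount (E.bcBondConfig ω) (startCorner hE) (n + 4) = turnCount (E.bcBondConfig ω) (startCorner hE) n :=
  fun _ hE _ _ _ _ hB1 hf1 hf2 hn h ho1 ho2 =>
    let t := touch_step hE hB1 hf1 hf2 hn h ho1 ho2
    ⟨t.1, t.2.2.2.2.1, t.2.2.2.2.2.2.2.2⟩

end Summit.CriticalPhenomena.CardyFormulaZ2.Theorems.ParafermionFamiliesToSLESix.FreeTrace

end
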